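import Summits.BirchSwinnertonDyer.BirchSwinnertonDyer.Theorems.EdixhovenFibreFiveSevenLTwistTransfer
import Summits.BirchSwinnertonDyer.BirchSwinnertonDyer.Theorems.EdixhovenFibreFiveSevenTwistDegreeStepFiveSevenKPTors
import Summits.BirchSwinnertonDyer.BirchSwinnertonDyer.Theorems.AdditiveKolyvaginRoadManinFrameResidueProperROfKatoLTwist
import Literature.NumberTheory.EllipticCurves.IsogenyIdProofs
import HarnessLib
/-!
# TDS57, KP57 and AKR crux #7 from F″ and the TRANSFER WITNESS — no Ihara lemma
# (route `EdixhovenFibreFiveSeven`, cruxes 22227 / 23810; route `AdditiveKolyvaginRoad`, crux 20709; `--supports`)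

Cell `pub/bsd-wall` (D-0145 line `route-BirchSwinnertonDyer-EdixhovenFibreFiveSeven`), seat `bsd-line-edix-p3`
(prover). THEOREMS ONLY (no definition, no named fact, no `sorry`). CONDITIONAL RESULTS; nothing is closed
unconditionally and BSD is not proved by this file.

State of the line before this file (p589348, p590967, p590858, p591838, p592227): every Manin binder at
`p ∈ {5, 7}` — TDS57 `TwistDegreeStepFiveSeven`, KP57 `KPResidueManinUnitFiveSeven`, AKR crux #7
`ManinFrameResidueProperR` — is a theorem GRANTED F″ (`kato_neron_isIntegral_twistedSymbolSum_of_additive_five_le`,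
cite-only), the THREE-COPY IHARA LEMMA `diamondRibet1997_iharaLemma_sq` (cite-only) and a Chebotarev witness.
This file removes Ihara: with the Ihara-free L-TWIST of `LTwistTransfer.lTwist_of_transfer` the same three
statements follow from F″ and the **TRANSFER WITNESS**

  `hW : ∀ p ∈ {5,7}, ∀ V₀ globally minimal, additive at p, E[p] irreducible, ∃ q prime, q ∤ 2 p N(V₀),`
  `      q* non-square mod p, p ∤ (q − 1)((q + 1)² − a_q(V₀)²)`

(an elementary consequence of Chebotarev in `ℚ(E[p], i)/ℚ`: `q ≢ 1`, `a_q ≢ ±(q+1) (mod p)`, `(q*/p) = −1`; a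
finite check shows such a Frobenius class exists for every irreducible image at `p ∈ {5,7}` — to be discharged
from the tree's `chebotarev_geomTorsion`; here it is a HYPOTHESIS, displayed, never asserted).

* `exists_datum_not_dvd_c_of_kato_of_transferWitness_of_torsion` — the Kosters–Pannekoek branch;
* `twistDegreeStepFiveSeven_of_kato_of_transferWitness : F″ → hW → TwistDegreeStepFiveSeven` (22227 BY NAME);
* `kpResidueManinUnitFiveSeven_of_kato_of_transferWitness : hnf → F″ → hW → KPResidueManinUnitFiveSeven` (23810);
* `maninFrameResidueProperR_of_kato_of_transferWitness : F″ → hW → ManinFrameResidueProperR` (AKR 20709).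

References: [Kato2004Asterisque] (8.1.3), Thm. 9.7; [KostersPannekoek2017] Thm. 1; [Stevens1989] (5.2), (5.4);
[Shimura1971] Prop. 3.38, 3.64; [AtkinLi1978] Thm. 3.1; [Mazur1977] III §5.
-/

set_option autoImplicit false
-- the Theorems directory repeats the summit name (sibling precedent `SignedBaseChangeAssembly.lean`)
set_option linter.dupNamespace false

noncomputable section

open scoped Classical MatrixGroups

open WeierstrassCurve NumberField Literature.NumberTheory.EllipticCurves
  Literature.NumberTheory.EllipticCurves.ModularForms
  Literature.NumberTheory.EllipticCurves.Rank1Residual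
  Literature.NumberTheory.DiophantineGeometry IsDedekindDomain Rat.HeightOneSpectrum
  Summit.BirchSwinnertonDyer.Rank1Residual Summit.BirchSwinnertonDyer.Rank1Residual.Additive
  Summit.BirchSwinnertonDyer.BirchSwinnertonDyer.Theorems
  Summit.BirchSwinnertonDyer.BirchSwinnertonDyer.Theses.EdixhovenFibreFiveSeven
  Summit.BirchSwinnertonDyer.BirchSwinnertonDyer.Theses.AdditiveKolyvaginRoad CongruenceSubgroup

namespace Summit.BirchSwinnertonDyer.BirchSwinnertonDyer.Theorems.LTwistTransfer

/-- **A conductor-level datum with `p ∤ c` on the Kosters–Pannekoek residue, GRANTED modularity, F″ and the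
transfer witness** — NO Ihara lemma. For `p ∈ {5, 7}` and `V/ℚ` globally minimal, additive at `p`, `E[p]`
irreducible, whose class contains a globally minimal member with a `ℚ_p`-rational point of order `p`: some
conductor-level datum `D` of `V` has `p ∤ c(D)`. Proof = the sibling
`KPResidueOfKatoPeriodTwist.exists_datum_not_dvd_c_of_kato_of_periodTwist_of_torsion` (p590967) with Dirichlet's
auxiliary prime replaced by the witness prime `q` of `hW` (for the optimal member `V₀`, which is additive at `p` with
`E[p]` irreducible) and L-TWIST supplied by `lTwist_of_transfer`.
[cite: Kato2004Asterisque, (8.1.3) (p. 180), Thm. 9.7 (p. 189)] [cite: KostersPannekoek2017, Thm. 1 and Cor. 2]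
[cite: Stevens1989, Lemma (5.2) p. 96] -/
theorem exists_datum_not_dvd_c_of_kato_of_transferWitness_of_torsion
    (hnf : exists_isNewformOf)
    (hF : kato_neron_isIntegral_twistedSymbolSum_of_additive_five_le)
    (hW : ∀ (p : ℕ) [Fact p.Prime] (V₀ : WeierstrassCurve ℚ) [V₀.IsElliptic] [V₀.IsGloballyMinimal],
      (p = 5 ∨ p = 7) → Addv V₀ p → Irr V₀ p →
      ∃ q : ℕ, q.Prime ∧ q ≠ 2 ∧ q ≠ p ∧ ¬ q ∣ V₀.conductorNorm ℤ ∧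
        ¬ IsSquare ((((-1 : ℤ) ^ (q / 2) * q : ℤ)) : ZMod p) ∧
        ¬ (p : ℤ) ∣ ((q : ℤ) - 1) * (((q : ℤ) + 1) ^ 2 - V₀.LFunction q ^ 2))
    {p : ℕ} [hp : Fact p.Prime] (V : WeierstrassCurve ℚ) [V.IsElliptic] [V.IsGloballyMinimal]
    [NeZero (V.conductorNorm ℤ)] (hp57 : p = 5 ∨ p = 7) (hadd : Addv V p) (hirr : Irr V p)
    (hW' : ∃ (W' : WeierstrassCurve ℚ) (_ : W'.IsElliptic) (_ : W'.IsGloballyMinimal)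
      (P : (W'.baseChange ℚ_[p]).toAffine.Point), IsIsogenous V W' ∧ P ≠ 0 ∧ p • P = 0) :
    ∃ D : ModularParametrizationData V (V.conductorNorm ℤ), ¬ (p : ℤ) ∣ D.c := by
  obtain ⟨W', hE', hM', P, hisoW', hP0, hP⟩ := hW'
  -- the optimal member of the class of `V`
  obtain ⟨V₀, hE₀, hM₀, hNz₀, D₀, hiso, -, hopt₀⟩ := X12.exists_isIsogenous_optimal hnf V
  haveI := hE₀
  haveI := hM₀
  haveI := hNz₀
  have hirr₀ : Irr V₀ p := (X12.irr_iff_of_isIsogenous hiso p).mp hirr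
  have hadd₀ : Addv V₀ p := (X2.addv_iff_of_isIsogenous (p := p) hiso).mp hadd
  have hisoVW : IsIsogenous V₀ W' := (hiso.symm_of_charZero).trans' hisoW'
  -- the witness prime
  obtain ⟨q, hq, hq2, hqp, hqN', hnsq, hu⟩ := hW p V₀ hp57 hadd₀ hirr₀
  haveI : Fact q.Prime := ⟨hq⟩
  have hqsq : ¬ q ^ 2 ∣ V₀.conductorNorm ℤ := fun h ↦ hqN' ((dvd_pow_self q two_ne_zero).trans h)
  have hgm : V₀.HasGoodReductionAtPrime q ∨ V₀.HasMultiplicativeReductionAtPrime q :=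
    hasGoodReductionAtPrime_or_hasMultiplicativeReductionAtPrime_of_not_sq_dvd_conductorNorm (V := V₀) hqsq
  -- a globally minimal model of the twist, and a square root of `q*`
  obtain ⟨Vχ, hEχ, hMχ, v, hv⟩ := exists_minimal_twist_pStar q V₀
  haveI := hEχ
  haveI := hMχ
  haveI : NeZero (Vχ.conductorNorm ℤ) := ⟨(Vχ.conductorNorm_pos_holds).ne'⟩
  have hv' : v • V₀.quadraticTwist (((-1 : ℤ) ^ (q / 2) * q : ℤ) : ℚ) = Vχ := by
    rw [(pStar_intCast q).1]; exact hv
  obtain ⟨s, hs2⟩ := IsAlgClosed.exists_pow_nat_eq ((((-1 : ℤ) ^ (q / 2) * q : ℤ)) : ℂ) two_pos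
  -- ADDV-UNIT-TWIST and TORS-TWIST are theorems at `p ∈ {5, 7}`
  have haddχ : Addv Vχ p := AddvUnitTwist.addv_of_model_twist_auxPrime (by omega) hq hqp hadd₀ ⟨v, hv'⟩
  have hPTχ := TorsTwist.torsTwist57_input p q V₀ hp57 hadd₀ hirr₀ hqp hnsq
    ⟨W', hE', hM', P, hisoVW, hP0, hP⟩ Vχ v hv'
  -- L-TWIST at the witness prime, WITHOUT Ihara
  have hL : ∀ (N' : ℕ) [NeZero N'] (g : CuspForm (Gamma0 N') 2), IsNewformOf Vχ g →
      ∀ z ∈ periodLattice D₀.f, ∃ w ∈ periodLattice g, ∃ y ∈ periodLattice D₀.f,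
        z = s * w + (p : ℂ) * y :=
    fun N' _ g hg ↦ lTwist_of_transfer V₀ D₀ hq2 hqp hqN' hu Vχ v hv' s hs2 g hg
  -- the repair: a conductor-level datum of `V` with `p ∤ c`
  exact TwistDegreeStepFiveSevenUnitTwist.exists_datum_not_dvd_c_of_kato_of_unitTwist hF hnf hp57 V hirr V₀
    hiso D₀ hopt₀ hq2 hgm Vχ v hv' haddχ hPTχ s hs2 hL

/-- **TDS57 `TwistDegreeStepFiveSeven` (stmt-BirchSwinnertonDyer-22227) from F″ and the transfer witness — NO
Ihara lemma.** Off the Kosters–Pannekoek sub-residue the tame-twist lever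
(`TwistDegreeStepFiveSeven.twistDegreeStep57_of_kato_of_noTorsion`); on it
`exists_datum_not_dvd_c_of_kato_of_transferWitness_of_torsion` and the step `twistDegreeStep57_of_not_dvd_c`.
Compare `LTwist.twistDegreeStepFiveSeven_of_kato_of_iharaSq_of_witness` (p591838): same conclusion with
Ihara³ + a non-Eisenstein witness. CONDITIONAL RESULT (F″ cite-only; `hW` a Chebotarev statement not yet in the
tree); the item stays open; BSD is not proved by this. [cite: Kato2004Asterisque, (8.1.3) (p. 180), Thm. 9.7 (p. 189)]
[cite: Stevens1989, Lemma (5.2) p. 96] -/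
theorem twistDegreeStepFiveSeven_of_kato_of_transferWitness
    (hF : kato_neron_isIntegral_twistedSymbolSum_of_additive_five_le)
    (hW : ∀ (p : ℕ) [Fact p.Prime] (V₀ : WeierstrassCurve ℚ) [V₀.IsElliptic] [V₀.IsGloballyMinimal],
      (p = 5 ∨ p = 7) → Addv V₀ p → Irr V₀ p →
      ∃ q : ℕ, q.Prime ∧ q ≠ 2 ∧ q ≠ p ∧ ¬ q ∣ V₀.conductorNorm ℤ ∧
        ¬ IsSquare ((((-1 : ℤ) ^ (q / 2) * q : ℤ)) : ZMod p) ∧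
        ¬ (p : ℤ) ∣ ((q : ℤ) - 1) * (((q : ℤ) + 1) ^ 2 - V₀.LFunction q ^ 2)) :
    TwistDegreeStepFiveSeven := by
  intro hnf p hp V _ _ _ Wf _ _ _ C hp57 hadd hirr hK hV4 hC
  have hp5 : 5 ≤ p := by omega
  by_cases hPT : ∀ (W' : WeierstrassCurve ℚ) [W'.IsElliptic] [W'.IsGloballyMinimal], IsIsogenous V W' →
      ∀ P : (W'.baseChange ℚ_[p]).toAffine.Point, p • P = 0 → P = 0
  · exact TwistDegreeStepFiveSeven.twistDegreeStep57_of_kato_of_noTorsion hF hnf V Wf C hp57 hadd hirr hK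
      hV4 hC hPT
  push Not at hPT
  obtain ⟨W', hE', hM', hisoW', P, hP, hP0⟩ := hPT
  obtain ⟨D, hc⟩ := exists_datum_not_dvd_c_of_kato_of_transferWitness_of_torsion hnf hF hW V hp57 hadd hirr
    ⟨W', hE', hM', P, hisoW', hP0, hP⟩
  exact ⟨D, TwistDegreeStepFiveSeven.twistDegreeStep57_of_not_dvd_c hp5 V Wf hadd hK hV4 C hC D hc⟩

/-- **KP57 `KPResidueManinUnitFiveSeven` (stmt-BirchSwinnertonDyer-23810) from modularity, F″ and the transfer
witness — NO Ihara lemma.** Of the item's hypotheses only `p ∈ {5, 7}`, additivity, `E[p]`-irreducibility and the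
`ℚ_p`-rational `p`-torsion witness are used. Compare `KPResidueOfKatoPeriodTwist.…_of_kato_of_periodTwist`
(p590967). CONDITIONAL RESULT; the item stays open; BSD is not proved by this.
[cite: KostersPannekoek2017, Thm. 1 and Cor. 2] [cite: Kato2004Asterisque, (8.1.3) (p. 180), Thm. 9.7 (p. 189)] -/
theorem kpResidueManinUnitFiveSeven_of_kato_of_transferWitness
    (hnf : exists_isNewformOf)
    (hF : kato_neron_isIntegral_twistedSymbolSum_of_additive_five_le)
    (hW : ∀ (p : ℕ) [Fact p.Prime] (V₀ : WeierstrassCurve ℚ) [V₀.IsElliptic] [V₀.IsGloballyMinimal],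
      (p = 5 ∨ p = 7) → Addv V₀ p → Irr V₀ p →
      ∃ q : ℕ, q.Prime ∧ q ≠ 2 ∧ q ≠ p ∧ ¬ q ∣ V₀.conductorNorm ℤ ∧
        ¬ IsSquare ((((-1 : ℤ) ^ (q / 2) * q : ℤ)) : ZMod p) ∧
        ¬ (p : ℤ) ∣ ((q : ℤ) - 1) * (((q : ℤ) + 1) ^ 2 - V₀.LFunction q ^ 2)) :
    KPResidueManinUnitFiveSeven := by
  intro p _ V _ _ _ hp57 hadd hirr _ _ hW' _ _
  exact exists_datum_not_dvd_c_of_kato_of_transferWitness_of_torsion hnf hF hW V hp57 hadd hirr hW'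

/-- **AKR crux #7 `ManinFrameResidueProperR` (stmt-BirchSwinnertonDyer-20709, route `AdditiveKolyvaginRoad`) from
F″ and the transfer witness — NO Ihara lemma.** The proof of the sibling
`ManinFrameResidueProperROfKatoLTwist.maninFrameResidueProperR_of_kato_of_lTwist` (manin-p1, p590858) with its
Kosters–Pannekoek branch (`p ∈ {5,7}`, a member with `ℚ_p`-rational `p`-torsion) served by
`exists_datum_not_dvd_c_of_kato_of_transferWitness_of_torsion` on `W` itself; the other branches are the tree's
`stub_memberManinUnit_fiveSeven_of_kato57` (no torsion) and `exists_member_not_dvd_c_of_tameTwistL` (`p ≥ 11`),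
both from F″ alone. CONDITIONAL RESULT; the item stays open; BSD is not proved by this.
[cite: Kato2004Asterisque, (8.1.3) (p. 180), Thm. 9.7 (p. 189)] [cite: KimNakamura2020, Cor. 2.4] -/
theorem maninFrameResidueProperR_of_kato_of_transferWitness
    (hK : kato_neron_isIntegral_twistedSymbolSum_of_additive_five_le)
    (hW : ∀ (p : ℕ) [Fact p.Prime] (V₀ : WeierstrassCurve ℚ) [V₀.IsElliptic] [V₀.IsGloballyMinimal],
      (p = 5 ∨ p = 7) → Addv V₀ p → Irr V₀ p →
      ∃ q : ℕ, q.Prime ∧ q ≠ 2 ∧ q ≠ p ∧ ¬ q ∣ V₀.conductorNorm ℤ ∧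
        ¬ IsSquare ((((-1 : ℤ) ^ (q / 2) * q : ℤ)) : ZMod p) ∧
        ¬ (p : ℤ) ∣ ((q : ℤ) - 1) * (((q : ℤ) + 1) ^ 2 - V₀.LFunction q ^ 2)) :
    ManinFrameResidueProperR := by
  intro _e1 _e2 dd hPub W _ _ p hp _ hp5 hadd hirr hres hall hr
  have hnf : exists_isNewformOf := hPub.2.2.2.2.2.1
  -- a member with a Manin-unit datum, by prime range and locus
  have hmem : ∃ (W₀ : WeierstrassCurve ℚ) (_ : W₀.IsElliptic) (_ : W₀.IsGloballyMinimal)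
      (D₀ : ModularParametrizationData W₀ (W.conductorNorm ℤ)),
      IsIsogenous W W₀ ∧ ¬ (p : ℤ) ∣ D₀.c := by
    rcases lt_or_ge p 11 with h11 | h11
    · by_cases hPT : ∀ (W' : WeierstrassCurve ℚ) (_ : W'.IsElliptic) (_ : W'.IsGloballyMinimal),
          IsIsogenous W W' → ∀ P : (W'.baseChange ℚ_[p]).toAffine.Point, p • P = 0 → P = 0
      · exact ManinFrameResidueProperRTameTwist.stub_memberManinUnit_fiveSeven_of_kato57 hK hnf W hp5 h11 hadd
          hirr hres hall (fun W' hE' hM' hiso P hP ↦ hPT W' hE' hM' hiso P hP)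
      · push Not at hPT
        obtain ⟨W', hE', hM', hiso, P, hP, hP0⟩ := hPT
        have hp57 : p = 5 ∨ p = 7 := by
          have hpr := hp.out
          interval_cases p
          · exact Or.inl rfl
          · exact absurd hpr (by norm_num)
          · exact Or.inr rfl
          · exact absurd hpr (by norm_num)
          · exact absurd hpr (by norm_num)
          · exact absurd hpr (by norm_num)
        obtain ⟨D, hc⟩ := exists_datum_not_dvd_c_of_kato_of_transferWitness_of_torsion hnf hK hW W hp57 hadd
          hirr ⟨W', hE', hM', P, hiso, hP0, hP⟩
        exact ⟨W, ‹_›, ‹_›, D, isIsogenous_self W, hc⟩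
    · -- F″ ⟹ F′ (the `7 < p` clause of F″ is void)
      exact ManinFrameResidueProperRTameTwist.exists_member_not_dvd_c_of_tameTwistL
        (fun V _ _ N _ f hf p _ h7 hg hm hi m _ hc χ hχp hχ1 hord ϖ r ↦
          hK V f hf p (by omega) hg hm hi m hc (Or.inl h7) χ hχp hχ1 hord ϖ r) hnf W h11 hadd hirr
  obtain ⟨W₀, hE₀, hM₀, D₀, hiso, hc₀⟩ := hmem
  haveI := hE₀
  haveI := hM₀
  -- transport to a datum of `W` with `p ∤ c` (prime-to-`p` isogeny multiplier under Irr)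
  obtain ⟨Dt, hc⟩ := ManinFrameTransport.exists_modularParametrizationData_not_dvd_of_partner W hp.out hirr hiso D₀ hc₀
  -- the Hoffstein–Luo odd Heegner frame
  have hp2 : p ≠ 2 := by omega
  exact ManinFrameFromDatum.exists_oddHeegnerFrame_of_exists_not_dvd hnf hPub.2.2.2.2.2.2.1 W p hr hp2 ⟨Dt, hc⟩

end Summit.BirchSwinnertonDyer.BirchSwinnertonDyer.Theorems.LTwistTransfer

end
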